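import Summits.HubbardSuperconductivity.HubbardSuperconductivity.Theorems.LadderThesis.Negative.FrameAverageTwistCost
import Summits.HubbardSuperconductivity.HubbardSuperconductivity.Theorems.NoGoNogoThesis
import HarnessLib

/-!
# Crux `LadderThesis` (stmt-HubbardSuperconductivity-1890): frame-AVERAGED twist ceilings, file 2

Negative-side support by the standing disprover (cdisprove, cycle 1; `Cruxes/LadderThesis/Disproof.lean`).
The tree's one-frame ceilings (`PinnedFrameBloch`, p93488) test a penalised / rigid state against the axis
frames `±eᵢ` and keep a caveat (`+ (s/2)(⟨Π_{eᵢ}⟩ + ⟨Π_{-eᵢ}⟩)`, resp. `∨`); running the same Bloch–Bohm/LSM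
test over the box of frames `mᵢ ≤ M` (file 1, `FrameAverageTwistCost`) and averaging with the
Kennedy–Lieb–Shastry sum rule `Σ_k ⟨Π_k⟩ ≤ 32` (p92715) removes it:
* `lro_penalisedGroundState_le_frameAverage` (Thm B) — `w(0) ≤ 32π²M²/s + 32/(M+1)²` (`M + 1 ≤ L`); hence
  `floor_mul_sqrt_penalty_le` (`a·√s ≤ 32(π²+1)` for the data of `LadderThesis`) and
  `not_ladderThesis_uniform_in_penalty` (the strengthening with `a` uniform in `s` is FALSE);
* `rigidityFloor_le_frameAverage` (Thm C) — rigidity data `(U, N, κ, a)` with `32π²M² ≤ κ`, `M + 1 ≤ L`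
  have `a ≤ 64/((M+1)²+1)`; hence `window_mul_floor_le_of_lowEnergyRigidityMatrix`: `κ·a ≤ 2048π²` for
  every instance of `LowEnergyRigidity` (stmt-1892, ≡ the crux by p89166) — the formal shadow of `κ < c·ρ_s`.
For a prover: the penalty strength is no free parameter (content at `s → 0⁺`, cf. p91441), and the rigidity
window is capped by the twist scale over the floor, uniformly in `(U, δ)`. Nothing here refutes an item.
Lieb–Schultz–Mattis (1961) App. B; Bohm (1949); Kaplan–Horsch–von der Linden (1989); Kennedy–Lieb–Shastry
(1988). No definitions; nothing asserts a Theses declaration.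
-/

noncomputable section

namespace Summit.HubbardSuperconductivity.LadderThesis.Negative

open Matrix Finset Complex Literature.MathematicalPhysics.QuantumLattice
  Literature.Probability.LatticeModels HubbardWave0
open Summit.HubbardSuperconductivity.HubbardSuperconductivity.Theorems.PinnedFrame
open scoped ComplexOrder ComplexConjugate Matrix.Norms.L2Operator

variable (L : ℕ) [NeZero L]
/-! ### Theorem B: the LRO floor of a penalised ground state decays in the penalty strength -/

/-- **Frame-averaged twist ceiling on the zero-mode weight of a penalised ground state.** For every
`U`, every `s > 0`, every joint sector, every unit sector ground state `φ` of `H_L + (s/L⁴)Δ_dᴴΔ_d` and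
every `M` with `M + 1 ≤ L`:
`L⁻⁴ Re⟨φ, Δ_dᴴΔ_d φ⟩ ≤ 32π²M²/s + 32/(M+1)²`.
(Sum the per-frame pinning ceiling over the `(M+1)² - 1` nonzero frames of the box `mᵢ ≤ M`, each of
twist cost `≤ 32π²M²`, and use the orbit sum rule.) In particular the floor `a` of any `LadderThesis`
witness decays at least like `s^{-1/2}` in the penalty strength, uniformly in `U, δ, L`: the penalty
side of the family has no free parameter. Caveat-free sharpening of the tree's
`ladderThesis_witness_ceiling` (one axis frame, `a·s ≤ 16π² + (s/2)(⟨Π_{eᵢ}⟩ + ⟨Π_{-eᵢ}⟩)`).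
Lieb–Schultz–Mattis (1961) App. B; Kaplan–Horsch–von der Linden (1989); Kennedy–Lieb–Shastry (1988). [folklore] -/
theorem lro_penalisedGroundState_le_frameAverage (U : ℝ) {s : ℝ} (hs : 0 < s) {N : ℕ} {Mz : ℝ}
    {φ : Fock (Orb (FermionTorus 2 L))} (hφ1 : star φ ⬝ᵥ φ = 1)
    (hφ : IsGroundStateInSector (hubbardTorus 2 L 1 U + ((s / (L : ℝ) ^ 4 : ℝ) : ℂ) •
      ((pairField dWaveFormFactor L)ᴴ * pairField dWaveFormFactor L)) N Mz φ)
    (M : ℕ) (hM : M + 1 ≤ L) :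
    (expect ((pairField dWaveFormFactor L)ᴴ * pairField dWaveFormFactor L) φ).re / (L : ℝ) ^ 4 ≤
      32 * Real.pi ^ 2 * (M : ℝ) ^ 2 / s + 32 / ((M : ℝ) + 1) ^ 2 := by
  classical
  set S : Finset (TorusSite 2 L) :=
    ((Finset.univ : Finset (TorusSite 2 L)).filter fun k => ∀ i, (k i).val ≤ M).erase 0 with hS
  have h0 : (0 : TorusSite 2 L) ∉ S := by rw [hS]; exact Finset.notMem_erase _ _
  have hcore := card_succ_mul_lro_le_sum_twistCost L U hs.le hφ1 hφ S h0
  have hcard : ((M : ℝ) + 1) ^ 2 ≤ (S.card : ℝ) + 1 := sq_le_card_frameBox_erase_add_one L M hM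
  -- each cost on the box is `≤ 32π²M²`
  have hcost : ∑ k ∈ S, (star φ ⬝ᵥ lsmPerturbation (fermionTorusGraph 2 L) (upTwistAngle L k) 1 *ᵥ φ).re ≤
      (S.card : ℝ) * (32 * Real.pi ^ 2 * (M : ℝ) ^ 2) := by
    have h : ∀ k ∈ S, (star φ ⬝ᵥ lsmPerturbation (fermionTorusGraph 2 L) (upTwistAngle L k) 1 *ᵥ φ).re ≤
        32 * Real.pi ^ 2 * (M : ℝ) ^ 2 := by
      intro k hk
      have hk' : ∀ i, (k i).val ≤ M := (Finset.mem_filter.1 (Finset.mem_of_mem_erase hk)).2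
      have := re_expect_lsmPerturbation_le_of_mem_frameBox L hk' φ
      rwa [hφ1, Complex.one_re, mul_one] at this
    have := Finset.sum_le_sum h
    rwa [Finset.sum_const, nsmul_eq_mul] at this
  set w₀ : ℝ := (expect ((pairField dWaveFormFactor L)ᴴ * pairField dWaveFormFactor L) φ).re / (L : ℝ) ^ 4
    with hw₀
  have hw₀nn : 0 ≤ w₀ := by
    rw [hw₀]
    exact div_nonneg (Summit.HubbardSuperconductivity.HubbardSuperconductivity.Theorems.DeformationLadder.re_expect_pairPenalty_nonneg L φ) (by positivity)
  -- `(|S|+1) s w₀ ≤ |S|·32π²M² + 32 s ≤ (|S|+1)·32π²M² + 32 s`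
  set C : ℝ := (S.card : ℝ) + 1 with hC
  have hC1 : 1 ≤ C := by rw [hC]; have : (0 : ℝ) ≤ S.card := Nat.cast_nonneg _; linarith
  have hCpos : 0 < C := by linarith
  have hmain : C * s * w₀ ≤ C * (32 * Real.pi ^ 2 * (M : ℝ) ^ 2) + 32 * s := by
    have hM2 : 0 ≤ 32 * Real.pi ^ 2 * (M : ℝ) ^ 2 := by positivity
    calc C * s * w₀ ≤ (S.card : ℝ) * (32 * Real.pi ^ 2 * (M : ℝ) ^ 2) + 32 * s := hcore.trans (by linarith)
      _ ≤ C * (32 * Real.pi ^ 2 * (M : ℝ) ^ 2) + 32 * s := by rw [hC]; nlinarith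
  -- divide by `C s`
  have hdiv : w₀ ≤ 32 * Real.pi ^ 2 * (M : ℝ) ^ 2 / s + 32 / C := by
    rw [div_add_div _ _ hs.ne' hCpos.ne', le_div_iff₀ (mul_pos hs hCpos)]
    nlinarith
  have hCM : 32 / C ≤ 32 / ((M : ℝ) + 1) ^ 2 :=
    div_le_div_of_nonneg_left (by norm_num) (by positivity) hcard
  linarith

/-- **Corollary: the floor times the square root of the penalty is bounded absolutely.** If the matrix
of `LadderThesis` holds with data `(U, δ, s, a, L₀)` (`δ ≥ -1`), then `a · √s ≤ 32(π² + 1)`: take a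
large even side `L` and `M = ⌊s^{1/4}⌋` in `lro_penalisedGroundState_le_frameAverage`. So the crux can
only hold with `a ≤ 32(π²+1)/√s`; compare the heuristic `a ≈ 2m⁴… 2|⟨Δ_x⟩|²` at `s ≲ ρ_s/|⟨Δ_x⟩|²`
(item note on stmt-1892). [folklore] -/
theorem floor_mul_sqrt_penalty_le (U δ : ℝ) {s a : ℝ} (hs : 0 < s) (L₀ : ℕ)
    (h : ∀ (L : ℕ) [NeZero L], L₀ ≤ L → Even L →
        ∃ φ : Fock (Orb (FermionTorus 2 L)), star φ ⬝ᵥ φ = 1 ∧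
          IsGroundStateInSector (hubbardTorus 2 L 1 U + ((s / (L : ℝ) ^ 4 : ℝ) : ℂ) •
            ((pairField dWaveFormFactor L)ᴴ * pairField dWaveFormFactor L))
            (2 * ⌊(1 - δ) * (L : ℝ) ^ 2 / 2⌋₊) 0 φ ∧
          a ≤ (expect ((pairField dWaveFormFactor L)ᴴ * pairField dWaveFormFactor L) φ).re /
            (L : ℝ) ^ 4) :
    a * Real.sqrt s ≤ 32 * (Real.pi ^ 2 + 1) := by
  -- `M = ⌊s^{1/4}⌋`, `L = 2·max(L₀, M+1)`
  set r : ℝ := Real.sqrt (Real.sqrt s) with hr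
  have hr0 : 0 < r := by rw [hr]; exact Real.sqrt_pos.2 (Real.sqrt_pos.2 hs)
  have hrs : r ^ 2 = Real.sqrt s := by rw [hr, Real.sq_sqrt (Real.sqrt_nonneg _)]
  have hss : Real.sqrt s ^ 2 = s := Real.sq_sqrt hs.le
  set M : ℕ := ⌊r⌋₊ with hM
  have hMr : (M : ℝ) ≤ r := Nat.floor_le hr0.le
  have hrM : r < (M : ℝ) + 1 := Nat.lt_floor_add_one r
  set L : ℕ := 2 * max L₀ (M + 1) with hL
  have hLpos : 0 < L := by rw [hL]; have := le_max_right L₀ (M + 1); omega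
  haveI : NeZero L := ⟨hLpos.ne'⟩
  have hL₀ : L₀ ≤ L := by rw [hL]; have := le_max_left L₀ (M + 1); omega
  have hML : M + 1 ≤ L := by rw [hL]; have := le_max_right L₀ (M + 1); omega
  obtain ⟨φ, hφ1, hφ, ha⟩ := h L hL₀ (by rw [hL]; exact even_two_mul _)
  have hB := lro_penalisedGroundState_le_frameAverage L U hs hφ1 hφ M hML
  -- `32π²M²/s ≤ 32π²/√s` and `32/(M+1)² ≤ 32/√s`
  have hsq0 : 0 < Real.sqrt s := Real.sqrt_pos.2 hs
  have h1 : 32 * Real.pi ^ 2 * (M : ℝ) ^ 2 / s ≤ 32 * Real.pi ^ 2 / Real.sqrt s := by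
    rw [div_le_div_iff₀ hs hsq0]
    have hM2 : (M : ℝ) ^ 2 ≤ Real.sqrt s := by
      rw [← hrs]; exact pow_le_pow_left₀ (Nat.cast_nonneg _) hMr 2
    have hpi : 0 ≤ 32 * Real.pi ^ 2 := by positivity
    have h3 : 32 * Real.pi ^ 2 * ((M : ℝ) ^ 2 * Real.sqrt s) ≤ 32 * Real.pi ^ 2 * (Real.sqrt s * Real.sqrt s) :=
      mul_le_mul_of_nonneg_left (mul_le_mul_of_nonneg_right hM2 hsq0.le) hpi
    have e : Real.sqrt s * Real.sqrt s = s := by rw [← sq, hss]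
    rw [e] at h3
    linarith
  have h2 : 32 / ((M : ℝ) + 1) ^ 2 ≤ 32 / Real.sqrt s := by
    apply div_le_div_of_nonneg_left (by norm_num) hsq0
    rw [← hrs]
    exact pow_le_pow_left₀ hr0.le hrM.le 2
  have hw : a ≤ 32 * Real.pi ^ 2 / Real.sqrt s + 32 / Real.sqrt s := by linarith
  rw [← add_div, le_div_iff₀ hsq0] at hw
  linarith

/-- **Corollary (a natural strengthening of the crux is FALSE): the floor cannot be uniform in the
penalty strength.** There are no `U > 0`, `δ ∈ (0, 1/2)`, `a > 0`, `L₀` such that for EVERY `s > 0` and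
every even `L ≥ L₀` some unit sector ground state of `H_L + (s/L⁴)Δ_dᴴΔ_d` has LRO density `≥ a`
(`LadderThesis` with `∃ s` moved inside and made universal): at `s > (32(π²+1)/a)²` the frame-averaged
ceiling forbids it. The crux's floor `a = a(s)` must degrade at least like `s^{-1/2}`; by the tree's
`ladderThesisMatrix_anti` it is antitone in `s`, so the content of the crux sits entirely at `s → 0⁺`
(`ladderThesis_iff_allSmallPenalties`). [folklore] -/
theorem not_ladderThesis_uniform_in_penalty :
    ¬ ∃ U : ℝ, 0 < U ∧ ∃ δ ∈ Set.Ioo (0:ℝ) (1 / 2), ∃ a : ℝ, 0 < a ∧ ∃ L₀ : ℕ, ∀ s : ℝ, 0 < s →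
      ∀ (L : ℕ) [NeZero L], L₀ ≤ L → Even L →
        ∃ φ : Fock (Orb (FermionTorus 2 L)), star φ ⬝ᵥ φ = 1 ∧
          IsGroundStateInSector (hubbardTorus 2 L 1 U + ((s / (L : ℝ) ^ 4 : ℝ) : ℂ) •
            ((pairField dWaveFormFactor L)ᴴ * pairField dWaveFormFactor L))
            (2 * ⌊(1 - δ) * (L : ℝ) ^ 2 / 2⌋₊) 0 φ ∧
          a ≤ (expect ((pairField dWaveFormFactor L)ᴴ * pairField dWaveFormFactor L) φ).re /
            (L : ℝ) ^ 4 := by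
  rintro ⟨U, -, δ, -, a, ha, L₀, h⟩
  -- the penalty `s = (64(π²+1)/a)²` is too strong for the floor `a`
  set s : ℝ := (64 * (Real.pi ^ 2 + 1) / a) ^ 2 with hs
  have hq : 0 < 64 * (Real.pi ^ 2 + 1) / a := by positivity
  have hs0 : 0 < s := by rw [hs]; positivity
  have hsqrt : Real.sqrt s = 64 * (Real.pi ^ 2 + 1) / a := by rw [hs, Real.sqrt_sq hq.le]
  have hle := floor_mul_sqrt_penalty_le U δ hs0 L₀ (h s hs0)
  rw [hsqrt] at hle
  have e : a * (64 * (Real.pi ^ 2 + 1) / a) = 64 * (Real.pi ^ 2 + 1) := by field_simp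
  rw [e] at hle
  nlinarith [Real.pi_pos]

/-! ### Theorem C: the rigidity window of `LowEnergyRigidity` (stmt-1892 ≡ the crux, p89166)
times its floor is bounded by an absolute constant -/

/-- **One of the two boosted copies of a pure ground state is rigid** (general winding; the tree's
`lowEnergyRigidity_ceiling` is the case `k = ±eᵢ`). Fix rigidity data `(U, N, κ, a)` at one side `L`
(every unit vector of the sector within `κ` of the sector energy has LRO density `≥ a`) and a unit
sector ground state `ψ` of `H_L`. If the twist cost of the frame `k` on `ψ` is `≤ κ`, then `ψ` carries
pair weight `≥ a` at winding `k` or at `-k`: `D_k⁻¹ψ`, `D_kψ` stay in the sector, their energies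
average to `E₀ + ⟨P_{θ_k}⟩_ψ ≤ E₀ + κ` (LSM identity), so one of them is rigid, and its zero-mode
weight is `ψ`'s weight at `±k` (covariance). Lieb–Schultz–Mattis (1961) App. B. [folklore] -/
theorem floor_le_weight_or_of_twistCost_le (U : ℝ) {κ a : ℝ} {N : ℕ}
    (hrig : ∀ φ : Fock (Orb (FermionTorus 2 L)), φ ∈ szSector N 0 → star φ ⬝ᵥ φ = 1 →
      (star φ ⬝ᵥ (hubbardTorus 2 L 1 U *ᵥ φ)).re ≤ (hubbardTorus 2 L 1 U).minEnergyOn (szSector N 0) + κ →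
        a ≤ (expect ((pairField dWaveFormFactor L)ᴴ * pairField dWaveFormFactor L) φ).re / (L : ℝ) ^ 4)
    (k : TorusSite 2 L) {ψ : Fock (Orb (FermionTorus 2 L))}
    (hψ1 : star ψ ⬝ᵥ ψ = 1) (hψ : IsGroundStateInSector (hubbardTorus 2 L 1 U) N 0 ψ)
    (hcost : (star ψ ⬝ᵥ lsmPerturbation (fermionTorusGraph 2 L) (upTwistAngle L k) 1 *ᵥ ψ).re ≤ κ) :
    a ≤ (expect ((upPairFieldAt dWaveFormFactor L k)ᴴ *
        upPairFieldAt dWaveFormFactor L k) ψ).re / (L : ℝ) ^ 4 ∨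
      a ≤ (expect ((upPairFieldAt dWaveFormFactor L (-k))ᴴ *
        upPairFieldAt dWaveFormFactor L (-k)) ψ).re / (L : ℝ) ^ 4 := by
  obtain ⟨hmem, -, heig⟩ := hψ
  set θ := upTwistAngle L k with hθ
  set P₀ := (pairField dWaveFormFactor L)ᴴ * pairField dWaveFormFactor L with hP₀
  set E₀ := (hubbardTorus 2 L 1 U).minEnergyOn (szSector N 0) with hE₀
  -- `ψ` has energy `E₀`
  have hEψ : (star ψ ⬝ᵥ (hubbardTorus 2 L 1 U *ᵥ ψ)).re = E₀ := by
    rw [heig, dotProduct_smul, hψ1, smul_eq_mul, mul_one, Complex.ofReal_re]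
  have hPneg : fockTwist (-θ) * P₀ * fockTwist θ =
      (upPairFieldAt dWaveFormFactor L (-k))ᴴ * upPairFieldAt dWaveFormFactor L (-k) := by
    rw [hθ, ← fockTwist_upTwistAngle_neg, show fockTwist (upTwistAngle L k) =
      fockTwist (-upTwistAngle L (-k)) by rw [← fockTwist_upTwistAngle_neg, neg_neg], hP₀,
      fockTwist_conj_pairPenalty_dWave]
  -- copy 1: `D⁻¹ψ`
  have hm1 := fockTwist_mulVec_mem_szSector (-θ) hmem
  have hu1 : star (fockTwist (-θ) *ᵥ ψ) ⬝ᵥ (fockTwist (-θ) *ᵥ ψ) = 1 := by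
    rw [star_mulVec_dotProduct, conjTranspose_fockTwist_mulVec_mulVec, hψ1]
  have hen1 : (star (fockTwist (-θ) *ᵥ ψ) ⬝ᵥ (hubbardTorus 2 L 1 U *ᵥ (fockTwist (-θ) *ᵥ ψ))).re =
      (star ψ ⬝ᵥ ((fockTwist θ * hubbardTorus 2 L 1 U * fockTwist (-θ)) *ᵥ ψ)).re := by
    rw [Matrix.star_mulVec_dotProduct_mulVec, conjTranspose_fockTwist, neg_neg]
  have hw1 : expect P₀ (fockTwist (-θ) *ᵥ ψ) =
      expect ((upPairFieldAt dWaveFormFactor L k)ᴴ * upPairFieldAt dWaveFormFactor L k) ψ := by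
    simp only [Literature.MathematicalPhysics.QuantumLattice.expect]
    rw [Matrix.star_mulVec_dotProduct_mulVec, conjTranspose_fockTwist, neg_neg, hP₀, hθ,
      fockTwist_conj_pairPenalty_dWave]
  -- copy 2: `Dψ`
  have hm2 := fockTwist_mulVec_mem_szSector θ hmem
  have hu2 : star (fockTwist θ *ᵥ ψ) ⬝ᵥ (fockTwist θ *ᵥ ψ) = 1 := by
    rw [star_mulVec_dotProduct, conjTranspose_fockTwist_mulVec_mulVec, hψ1]
  have hen2 : (star (fockTwist θ *ᵥ ψ) ⬝ᵥ (hubbardTorus 2 L 1 U *ᵥ (fockTwist θ *ᵥ ψ))).re =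
      (star ψ ⬝ᵥ ((fockTwist (-θ) * hubbardTorus 2 L 1 U * fockTwist θ) *ᵥ ψ)).re := by
    rw [Matrix.star_mulVec_dotProduct_mulVec, conjTranspose_fockTwist]
  have hw2 : expect P₀ (fockTwist θ *ᵥ ψ) =
      expect ((upPairFieldAt dWaveFormFactor L (-k))ᴴ * upPairFieldAt dWaveFormFactor L (-k)) ψ := by
    simp only [Literature.MathematicalPhysics.QuantumLattice.expect]
    rw [Matrix.star_mulVec_dotProduct_mulVec, conjTranspose_fockTwist, hPneg]
  -- LSM: `e₊ + e₋ = 2E₀ + 2⟨P_θ⟩_ψ ≤ 2E₀ + 2κ`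
  have htwo : ∀ z : ℂ, ((2 : ℂ) * z).re = 2 * z.re := fun z => by simp [Complex.mul_re]
  have hsum := congrArg (fun T => (star ψ ⬝ᵥ (T *ᵥ ψ)).re)
    (frameHamiltonian_add_frameHamiltonian_neg L U k)
  simp only [add_mulVec, dotProduct_add, Complex.add_re, smul_mulVec, dotProduct_smul, smul_eq_mul,
    htwo] at hsum
  rw [← hθ, hEψ] at hsum
  by_cases hcase : (star ψ ⬝ᵥ ((fockTwist θ * hubbardTorus 2 L 1 U * fockTwist (-θ)) *ᵥ ψ)).re ≤ E₀ + κ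
  · left
    have h := hrig _ hm1 hu1 (by rw [hen1]; exact hcase)
    rwa [hw1] at h
  · right
    have hcase' : (star ψ ⬝ᵥ ((fockTwist (-θ) * hubbardTorus 2 L 1 U * fockTwist θ) *ᵥ ψ)).re ≤ E₀ + κ := by
      push Not at hcase
      linarith
    have h := hrig _ hm2 hu2 (by rw [hen2]; exact hcase')
    rwa [hw2] at h

/-- **Frame-averaged twist ceiling on the rigidity floor.** Fix rigidity data `(U, N, κ, a)` at one
side `L` and `M` with `M + 1 ≤ L` and `32π²M² ≤ κ` (every frame of the box `mᵢ ≤ M` costs `≤ κ`).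
If the sector has a unit ground state `ψ`, then `a ≤ 64 / ((M+1)² + 1)`: every nonzero frame of the
box puts weight `≥ a` at `k` or `-k`, `ψ` itself is rigid (`w(0) ≥ a`), and all weights sum to `≤ 32`.
Hence `κ · a < 2048π²` for every instance of `LowEnergyRigidity` (next corollary): the O(1) rigidity
window can never exceed the twist scale divided by the floor — the refuter's one-flux constraint
`κ < c ρ_s` (item note on stmt-1892) in a form that needs no knowledge of `ρ_s` or of the state.
Lieb–Schultz–Mattis (1961) App. B; Kennedy–Lieb–Shastry, PRL 61 (1988) 2582. [folklore] -/
theorem rigidityFloor_le_frameAverage (U : ℝ) {κ a : ℝ} {N : ℕ}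
    (hrig : ∀ φ : Fock (Orb (FermionTorus 2 L)), φ ∈ szSector N 0 → star φ ⬝ᵥ φ = 1 →
      (star φ ⬝ᵥ (hubbardTorus 2 L 1 U *ᵥ φ)).re ≤ (hubbardTorus 2 L 1 U).minEnergyOn (szSector N 0) + κ →
        a ≤ (expect ((pairField dWaveFormFactor L)ᴴ * pairField dWaveFormFactor L) φ).re / (L : ℝ) ^ 4)
    (M : ℕ) (hM : M + 1 ≤ L) (hκ : 32 * Real.pi ^ 2 * (M : ℝ) ^ 2 ≤ κ)
    {ψ : Fock (Orb (FermionTorus 2 L))} (hψ1 : star ψ ⬝ᵥ ψ = 1)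
    (hψ : IsGroundStateInSector (hubbardTorus 2 L 1 U) N 0 ψ) :
    a ≤ 64 / (((M : ℝ) + 1) ^ 2 + 1) := by
  classical
  have hL0 : (0 : ℝ) < L := by exact_mod_cast Nat.pos_of_ne_zero (NeZero.ne L)
  have hL4 : (0 : ℝ) < (L : ℝ) ^ 4 := by positivity
  set S : Finset (TorusSite 2 L) :=
    ((Finset.univ : Finset (TorusSite 2 L)).filter fun k => ∀ i, (k i).val ≤ M).erase 0 with hS
  have h0 : (0 : TorusSite 2 L) ∉ S := by rw [hS]; exact Finset.notMem_erase _ _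
  have hcard : ((M : ℝ) + 1) ^ 2 ≤ (S.card : ℝ) + 1 := sq_le_card_frameBox_erase_add_one L M hM
  set w : TorusSite 2 L → ℝ := fun k =>
    (star ψ ⬝ᵥ (((upPairFieldAt dWaveFormFactor L k)ᴴ * upPairFieldAt dWaveFormFactor L k) *ᵥ ψ)).re
    with hw
  set P : ℝ := (star ψ ⬝ᵥ (((pairField dWaveFormFactor L)ᴴ * pairField dWaveFormFactor L) *ᵥ ψ)).re
    with hP
  have hw0 : ∀ k, 0 ≤ w k := fun k => re_expect_upPenalty_nonneg L k ψ
  -- every nonzero frame of the box: `a L⁴ ≤ w k + w (-k)`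
  have hk : ∀ k ∈ S, a * (L : ℝ) ^ 4 ≤ w k + w (-k) := by
    intro k hkS
    have hk' : ∀ i, (k i).val ≤ M := (Finset.mem_filter.1 (Finset.mem_of_mem_erase hkS)).2
    have hc := re_expect_lsmPerturbation_le_of_mem_frameBox L hk' ψ
    rw [hψ1, Complex.one_re, mul_one] at hc
    rcases floor_le_weight_or_of_twistCost_le L U hrig k hψ1 hψ (hc.trans hκ) with h | h
    · simp only [Literature.MathematicalPhysics.QuantumLattice.expect] at h
      rw [le_div_iff₀ hL4] at h
      linarith [hw0 (-k)]
    · simp only [Literature.MathematicalPhysics.QuantumLattice.expect] at h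
      rw [le_div_iff₀ hL4] at h
      linarith [hw0 k]
  have hsumk := Finset.sum_le_sum hk
  rw [Finset.sum_const, nsmul_eq_mul, Finset.sum_add_distrib] at hsumk
  have h1 : ∑ k ∈ S, w k ≤ 32 * (L : ℝ) ^ 4 - P := sum_re_expect_upPenalty_le_of_zero_not_mem L hψ1 S h0
  have h2 : ∑ k ∈ S, w (-k) ≤ 32 * (L : ℝ) ^ 4 - P :=
    sum_re_expect_upPenalty_neg_le_of_zero_not_mem L hψ1 S h0
  -- `ψ` itself is rigid: `a L⁴ ≤ P`
  have hψP : a * (L : ℝ) ^ 4 ≤ P := by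
    obtain ⟨hmem, -, heig⟩ := hψ
    have hEψ : (star ψ ⬝ᵥ (hubbardTorus 2 L 1 U *ᵥ ψ)).re =
        (hubbardTorus 2 L 1 U).minEnergyOn (szSector N 0) := by
      rw [heig, dotProduct_smul, hψ1, smul_eq_mul, mul_one, Complex.ofReal_re]
    have hκ0 : 0 ≤ κ := le_trans (by positivity) hκ
    have h := hrig ψ hmem hψ1 (by rw [hEψ]; linarith)
    simp only [Literature.MathematicalPhysics.QuantumLattice.expect] at h
    rwa [le_div_iff₀ hL4] at h
  -- `(|S| + 2) a ≤ 64`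
  have hmain : ((S.card : ℝ) + 2) * a ≤ 64 := by
    have : ((S.card : ℝ) + 2) * (a * (L : ℝ) ^ 4) ≤ 64 * (L : ℝ) ^ 4 := by nlinarith
    have e : ((S.card : ℝ) + 2) * (a * (L : ℝ) ^ 4) = (((S.card : ℝ) + 2) * a) * (L : ℝ) ^ 4 := by ring
    rw [e] at this
    exact le_of_mul_le_mul_right this hL4
  have hden : 0 < ((M : ℝ) + 1) ^ 2 + 1 := by positivity
  rw [le_div_iff₀ hden]
  rcases le_or_gt a 0 with ha | ha
  · nlinarith
  · nlinarith

/-- **Corollary: `κ · a ≤ 2048π²` for every instance of the matrix of `LowEnergyRigidity`.** If, for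
some `U`, `δ ≥ -1`, `κ ≥ 0`, `a`, `L₀`, every unit vector of the sector `(N_L, 0)` within `κ` of the
sector energy has LRO density `≥ a` at all even `L ≥ L₀`, then `κ · a ≤ 2048π²`
(`M = ⌊√(κ/32π²)⌋`, a large even side, a unit sector ground state from
`exists_unit_groundStateInSector_hubbardTorus`, and `rigidityFloor_le_frameAverage`). The crux
`LadderThesis` is `LowEnergyRigidity` up to constants (`ladderThesis_iff_lowEnergyRigidity`, p89166). [folklore] -/
theorem window_mul_floor_le_of_lowEnergyRigidityMatrix (U δ : ℝ) (hδ : -1 ≤ δ) {κ a : ℝ}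
    (hκ : 0 ≤ κ) (L₀ : ℕ)
    (h : ∀ (L : ℕ) [NeZero L], L₀ ≤ L → Even L →
      ∀ φ : Fock (Orb (FermionTorus 2 L)), φ ∈ szSector (2 * ⌊(1 - δ) * (L : ℝ) ^ 2 / 2⌋₊) 0 →
        star φ ⬝ᵥ φ = 1 →
          (star φ ⬝ᵥ Matrix.mulVec (hubbardTorus 2 L 1 U) φ).re ≤
            (hubbardTorus 2 L 1 U).minEnergyOn (szSector (2 * ⌊(1 - δ) * (L : ℝ) ^ 2 / 2⌋₊) 0) + κ →
          a ≤ (expect ((pairField dWaveFormFactor L)ᴴ * pairField dWaveFormFactor L) φ).re / (L : ℝ) ^ 4) :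
    κ * a ≤ 2048 * Real.pi ^ 2 := by
  set x : ℝ := Real.sqrt (κ / (32 * Real.pi ^ 2)) with hx
  have hx0 : 0 ≤ x := Real.sqrt_nonneg _
  have hpi : 0 < 32 * Real.pi ^ 2 := by positivity
  have hxsq : x ^ 2 = κ / (32 * Real.pi ^ 2) := by rw [hx, Real.sq_sqrt (div_nonneg hκ hpi.le)]
  set M : ℕ := ⌊x⌋₊ with hM
  have hMx : (M : ℝ) ≤ x := Nat.floor_le hx0
  have hxM : x < (M : ℝ) + 1 := Nat.lt_floor_add_one x
  -- `32π²M² ≤ κ < 32π²(M+1)²`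
  have hκM : 32 * Real.pi ^ 2 * (M : ℝ) ^ 2 ≤ κ := by
    have hM2 : (M : ℝ) ^ 2 ≤ κ / (32 * Real.pi ^ 2) := by
      rw [← hxsq]; exact pow_le_pow_left₀ (Nat.cast_nonneg _) hMx 2
    rw [le_div_iff₀ hpi] at hM2
    linarith
  have hκM' : κ < 32 * Real.pi ^ 2 * ((M : ℝ) + 1) ^ 2 := by
    have hM2 : κ / (32 * Real.pi ^ 2) < ((M : ℝ) + 1) ^ 2 := by
      rw [← hxsq]; exact pow_lt_pow_left₀ hxM hx0 two_ne_zero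
    rw [div_lt_iff₀ hpi] at hM2
    linarith
  -- a large even side and a unit sector ground state there
  set L : ℕ := 2 * max L₀ (M + 1) with hL
  have hLpos : 0 < L := by rw [hL]; have := le_max_right L₀ (M + 1); omega
  haveI : NeZero L := ⟨hLpos.ne'⟩
  have hL₀ : L₀ ≤ L := by rw [hL]; have := le_max_left L₀ (M + 1); omega
  have hML : M + 1 ≤ L := by rw [hL]; have := le_max_right L₀ (M + 1); omega
  have hn := Summit.HubbardSuperconductivity.NoGo.floor_pairNumber_le δ hδ L
  obtain ⟨ψ, hψ1, hψ⟩ :=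
    Summit.HubbardSuperconductivity.NoGo.exists_unit_groundStateInSector_hubbardTorus L 1 U hn
  have hC := rigidityFloor_le_frameAverage L U (h L hL₀ (by rw [hL]; exact even_two_mul _)) M hML hκM hψ1 hψ
  have hden : 0 < ((M : ℝ) + 1) ^ 2 + 1 := by positivity
  rcases le_or_gt a 0 with ha | ha
  · nlinarith [Real.pi_pos]
  · -- `κ a ≤ κ · 64/((M+1)²+1) < 32π²(M+1)² · 64/((M+1)²+1) ≤ 2048π²`
    have h1 : κ * a ≤ κ * (64 / (((M : ℝ) + 1) ^ 2 + 1)) := mul_le_mul_of_nonneg_left hC hκ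
    have h2 : κ * (64 / (((M : ℝ) + 1) ^ 2 + 1)) ≤
        32 * Real.pi ^ 2 * ((M : ℝ) + 1) ^ 2 * (64 / (((M : ℝ) + 1) ^ 2 + 1)) :=
      mul_le_mul_of_nonneg_right hκM'.le (by positivity)
    have h3 : 32 * Real.pi ^ 2 * ((M : ℝ) + 1) ^ 2 * (64 / (((M : ℝ) + 1) ^ 2 + 1)) ≤ 2048 * Real.pi ^ 2 := by
      rw [mul_div_assoc', div_le_iff₀ hden]
      nlinarith [Real.pi_pos, sq_nonneg ((M : ℝ) + 1)]
    linarith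

end Summit.HubbardSuperconductivity.LadderThesis.Negative
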